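import Literature.MathematicalPhysics.QuantumFieldTheory.Balaban1983to89.B4Eq19LatticePoincareMorrey
import Literature.MathematicalPhysics.QuantumFieldTheory.Balaban1983to89.B4Eq19LatticeBoxMeans
import HarnessLib

/-!
# Route `UnitScaleTilt`, crux K1 «MinimiserStabilityRegPr» (stmt-QuantumFields-19200), route-R E′ path (α′) — the sup-row residue (hK), brick (D1-cell), part 1 of 2:
# THE `ℓ²` POINCARÉ INEQUALITY ON A LATTICE BOX AND THE MORREY-SPACE TELESCOPING OF BOX AVERAGES

Cell `ym3-torus`, D-0154 (3c) twin-width seat `ym-routeR-w2` (gen 5).  THEOREMS ONLY (0 `def`, 0 `sorry`); `--supports stmt-QuantumFields-19200 --as helper`,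
count-neutral.  YM₃ on T³ is a ladder rung (R3), not the Clay problem; nothing here claims the stub, the crux, d = 4 or the gap.

THE POINT (★routeR-w3 g5 17:53:25Z dissection of (hK), item (D1); LOCATE `ym-routeR-w2/LOCATE-HK-D1-ROWS-routeRw2g5.md` §2 (a)–(b)).  Part 2 (`…VertexPinnedMorreyCell`)
feeds ✓ `abs_sub_le_of_morrey` with the growth `gradSq (u − m·x)(Q_ρ) ≤ N(ρ+1)²`, which needs two tools the tree has only in `ℓ¹` form: (i) the `ℓ²` Poincaré inequality on a
box, (ii) the comparison of box averages across dyadic scales in the MORREY space `L^{2,2}(ℤ³)` (`exc ≤ A(r+1)²`; ✓ `sq_sub_le_of_campanato`'s exponent `d+1` does not apply).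

WHAT IS PROVED (ns `…Theorems.Prop7LatticeBoxPoincareL2`).
* §1 (any `d`) `abs_sub_update_le_lineVar`, `sum_sq_sub_update_le` (line telescoping, Cauchy–Schwarz), `add_sq_le_weighted`, ★ `exc_le_gradSq`:
  `exc v z ρ ≤ d·(2ρ+1)²·gradSq v (Q_ρ(z))` — one-coordinate averaging, the `ℓ²` twin of ✓ `exists_poincare_l1` (induction on the set of averaged coordinates with the
  invariant `Σ_Q (v − w_T)² ≤ |T|(2ρ+1)² Σ_{i∈T} Σ_Q (∂_iv)²`).
* §2 (`d = 3`) `card_box_three`; `sq_boxAvg_dyadic_step` (`(avg_{r_k} − avg_{r_{k+1}})² ≤ 4A(ρ+1)⁻¹2^{−k}`, `r_k + 1 = 2^k(ρ+1)`); ★ `sq_boxAvg_sub_dyadic_le`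
  (`(avg_ρ − avg_{r_K})² ≤ 64A∕(ρ+1)`, geometric majorant `(3∕4)^k`); ★ `card_mul_sq_boxAvg_sub_master_le` (`#Q_ρ(a)·(avg_{Q_r(a)} − avg_{Q_R(z₀)})² ≤ 128A(ρ+1)²` for
  `Q_r(a) ⊆ Q_R(z₀)`, `(R+1)² ≤ 16(r+1)²`).
HONEST SCOPE.  Folklore real-variable lattice analysis; constants ours, not sharp.  References: M. Giaquinta, *Multiple integrals in the calculus of variations and
nonlinear elliptic systems*, Princeton 1983 [Giaquinta1984] (Ch. III §1 pp.64–72); T. Bałaban, CMP 96 (1984) 223–250 [Balaban1984PropagatorsII] ((1.9) p.226).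
-/

set_option autoImplicit false

noncomputable section

open scoped BigOperators

namespace Summit.QuantumFields.YangMills.Theorems.Prop7LatticeBoxPoincareL2

open Literature.MathematicalPhysics.QuantumFieldTheory.Balaban1983to89
open B4Eq19LatticeOperators B4Eq19LatticeBoxMeans B4Eq19LatticePoincareMorrey Finset

variable {d : ℕ}
/-! ## §1 The `ℓ²` Poincaré inequality on a box -/

/-- telescoping along a coordinate line: `|v(x[j:=a]) − v(x[j:=a+m])| ≤ Σ_{t<m} |∂_j v(x[j:=a+t])|`. [folklore] [cite: Giaquinta1984, Ch. III §1 p.65] -/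
theorem abs_sub_update_le_sum_range (v : Zd d → ℝ) (x : Zd d) (j : Fin d) (a : ℤ) (m : ℕ) :
    |v (Function.update x j a) - v (Function.update x j (a + m))| ≤ ∑ t ∈ Finset.range m, |fdiff j v (Function.update x j (a + t))| := by
  induction m with
  | zero => simp
  | succ m ih =>
    have h2 : v (Function.update x j (a + m)) - v (Function.update x j (a + (m + 1 : ℕ))) = -fdiff j v (Function.update x j (a + m)) := by
      rw [fdiff]
      have : Function.update x j (a + m) + unitVec j = Function.update x j (a + ((m + 1 : ℕ) : ℤ)) := by
        funext i
        by_cases hi : i = j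
        · subst hi; simp; ring
        · simp [Function.update_of_ne hi, unitVec_apply_ne hi]
      rw [this]; ring
    rw [Finset.sum_range_succ]
    calc |v (Function.update x j a) - v (Function.update x j (a + (m + 1 : ℕ)))|
        = |(v (Function.update x j a) - v (Function.update x j (a + m))) + (v (Function.update x j (a + m)) - v (Function.update x j (a + (m + 1 : ℕ))))| := by
          ring_nf
      _ ≤ |v (Function.update x j a) - v (Function.update x j (a + m))| + |v (Function.update x j (a + m)) - v (Function.update x j (a + (m + 1 : ℕ)))| :=
          abs_add_le _ _
      _ ≤ ∑ t ∈ Finset.range m, |fdiff j v (Function.update x j (a + t))| + |fdiff j v (Function.update x j (a + (m : ℕ)))| := by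
          rw [h2, abs_neg]; linarith

/-- two points of a coordinate line inside the box differ by at most the `ℓ¹` line variation: for `x ∈ Q_ρ(z)`, `s ∈ I_j`,
`|v(x) − v(x[j:=s])| ≤ Σ_{t ∈ I_j} |∂_j v(x[j:=t])|`. [folklore] [cite: Giaquinta1984, Ch. III §1 p.65] -/
theorem abs_sub_update_le_lineVar (z : Zd d) {ρ : ℤ} (j : Fin d) (v : Zd d → ℝ) {x : Zd d} (hx : x ∈ box z ρ) {s : ℤ}
    (hs : s ∈ Finset.Icc (z j - ρ) (z j + ρ)) :
    |v x - v (Function.update x j s)| ≤ ∑ t ∈ Finset.Icc (z j - ρ) (z j + ρ), |fdiff j v (Function.update x j t)| := by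
  classical
  set I := Finset.Icc (z j - ρ) (z j + ρ) with hI
  set V := ∑ t ∈ I, |fdiff j v (Function.update x j t)| with hV
  have range_le : ∀ (a : ℤ) (m : ℕ), a ∈ I → a + m ∈ I → ∑ t ∈ Finset.range m, |fdiff j v (Function.update x j (a + t))| ≤ V := by
    intro a m ha ham
    rw [hI, Finset.mem_Icc] at ha ham
    have hinj : ∀ t ∈ Finset.range m, ∀ t' ∈ Finset.range m, (fun t : ℕ => a + t) t = (fun t : ℕ => a + t) t' → t = t' := by
      intro t _ t' _ h; simp only [add_right_inj, Nat.cast_inj] at h; exact h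
    rw [← Finset.sum_image (f := fun s => |fdiff j v (Function.update x j s)|) hinj]
    refine Finset.sum_le_sum_of_subset_of_nonneg (fun s hs => ?_) fun _ _ _ => abs_nonneg _
    rw [Finset.mem_image] at hs
    obtain ⟨t, ht, rfl⟩ := hs
    rw [Finset.mem_range] at ht
    rw [hI, Finset.mem_Icc]; constructor
    · linarith [ha.1]
    · have : (t : ℤ) ≤ m := by exact_mod_cast ht.le
      linarith [ham.2]
  have pair : ∀ s ∈ I, ∀ s' ∈ I, |v (Function.update x j s) - v (Function.update x j s')| ≤ V := by
    intro s hs s' hs'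
    rcases le_total s s' with h | h
    · obtain ⟨m, hm⟩ : ∃ m : ℕ, s' = s + m := ⟨(s' - s).toNat, by rw [Int.toNat_of_nonneg (by linarith)]; ring⟩
      rw [hm] at hs' ⊢
      exact (abs_sub_update_le_sum_range v x j s m).trans (range_le s m hs hs')
    · obtain ⟨m, hm⟩ : ∃ m : ℕ, s = s' + m := ⟨(s - s').toNat, by rw [Int.toNat_of_nonneg (by linarith)]; ring⟩
      rw [hm] at hs ⊢
      rw [abs_sub_comm]
      exact (abs_sub_update_le_sum_range v x j s' m).trans (range_le s' m hs' hs)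
  have hxj : x j ∈ I := by
    rw [hI, Finset.mem_Icc]; have := (mem_box.1 hx) j; rw [abs_le] at this; constructor <;> linarith [this.1, this.2]
  have := pair (x j) hxj s hs
  rwa [Function.update_eq_self] at this

/-- the cardinality of the coordinate interval `I_j = [z_j − ρ, z_j + ρ]` is `2ρ+1`. [folklore] -/
theorem card_Icc_line (z : Zd d) {ρ : ℤ} (hρ : 0 ≤ ρ) (j : Fin d) :
    ((Finset.Icc (z j - ρ) (z j + ρ)).card : ℝ) = ((2 * ρ + 1 : ℤ) : ℝ) := by
  rw [Int.card_Icc, show z j + ρ + 1 - (z j - ρ) = 2 * ρ + 1 by ring]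
  have : (0 : ℤ) ≤ 2 * ρ + 1 := by linarith
  rw [← Int.cast_natCast, Int.toNat_of_nonneg this]

/-- `ℓ²` along a line: for `x ∈ Q_ρ(z)`, `Σ_{s∈I_j} (v(x) − v(x[j:=s]))² ≤ (2ρ+1)²·Σ_{t∈I_j} (∂_j v(x[j:=t]))²` (the pointwise line bound squared, Cauchy–Schwarz).
[folklore] [cite: Giaquinta1984, Ch. III §1 p.65] -/
theorem sum_sq_sub_update_le (z : Zd d) {ρ : ℤ} (hρ : 0 ≤ ρ) (j : Fin d) (v : Zd d → ℝ) {x : Zd d} (hx : x ∈ box z ρ) :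
    ∑ s ∈ Finset.Icc (z j - ρ) (z j + ρ), (v x - v (Function.update x j s)) ^ 2 ≤
      ((2 * ρ + 1 : ℤ) : ℝ) ^ 2 * ∑ t ∈ Finset.Icc (z j - ρ) (z j + ρ), (fdiff j v (Function.update x j t)) ^ 2 := by
  classical
  set I := Finset.Icc (z j - ρ) (z j + ρ) with hI
  set n : ℝ := ((2 * ρ + 1 : ℤ) : ℝ) with hn
  have hcard : (I.card : ℝ) = n := by rw [hI, hn]; exact card_Icc_line z hρ j
  -- Cauchy–Schwarz on the line variation
  have hCS : (∑ t ∈ I, |fdiff j v (Function.update x j t)|) ^ 2 ≤ n * ∑ t ∈ I, (fdiff j v (Function.update x j t)) ^ 2 := by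
    have h := sq_sum_le_card_mul_sum_sq (s := I) (f := fun t => |fdiff j v (Function.update x j t)|)
    simp only [sq_abs] at h
    rw [hcard] at h
    exact h
  have hpt : ∀ s ∈ I, (v x - v (Function.update x j s)) ^ 2 ≤ n * ∑ t ∈ I, (fdiff j v (Function.update x j t)) ^ 2 := by
    intro s hs
    have h1 := abs_sub_update_le_lineVar z j v hx hs
    have h0 : 0 ≤ |v x - v (Function.update x j s)| := abs_nonneg _
    calc (v x - v (Function.update x j s)) ^ 2 = |v x - v (Function.update x j s)| ^ 2 := (sq_abs _).symm
      _ ≤ (∑ t ∈ I, |fdiff j v (Function.update x j t)|) ^ 2 := pow_le_pow_left₀ h0 h1 2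
      _ ≤ n * ∑ t ∈ I, (fdiff j v (Function.update x j t)) ^ 2 := hCS
  calc ∑ s ∈ I, (v x - v (Function.update x j s)) ^ 2 ≤ ∑ s ∈ I, n * ∑ t ∈ I, (fdiff j v (Function.update x j t)) ^ 2 :=
        Finset.sum_le_sum hpt
    _ = n ^ 2 * ∑ t ∈ I, (fdiff j v (Function.update x j t)) ^ 2 := by rw [Finset.sum_const, nsmul_eq_mul, hcard]; ring

/-- `(a + b)² ≤ (1 + 1/t)·a² + (1 + t)·b²` for `t > 0`. [folklore] -/
theorem add_sq_le_weighted (a b : ℝ) {t : ℝ} (ht : 0 < t) : (a + b) ^ 2 ≤ (1 + 1 / t) * a ^ 2 + (1 + t) * b ^ 2 := by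
  have h := sq_nonneg (a - t * b)
  have e : ((1 + 1 / t) * a ^ 2 + (1 + t) * b ^ 2) * t - (a + b) ^ 2 * t = (a - t * b) ^ 2 := by field_simp; ring
  have hmul : (a + b) ^ 2 * t ≤ ((1 + 1 / t) * a ^ 2 + (1 + t) * b ^ 2) * t := by linarith [h, e]
  exact le_of_mul_le_mul_right hmul ht

/-- ★ **THE `ℓ²` POINCARÉ INEQUALITY ON A BOX** (by averaging one coordinate at a time): `exc v z ρ ≤ d·(2ρ+1)²·gradSq v (Q_ρ(z))`.
(Induction on the set `T` of averaged coordinates, the `ℓ²` twin of ✓ `exists_poincare_l1`: there is `w`, depending only on the coordinates outside `T` on `Q`, with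
`Σ_Q (∂_i w)² ≤ Σ_Q (∂_i v)²` for `i ∉ T` and `Σ_Q (v − w)² ≤ |T|·(2ρ+1)²·Σ_{i∈T} Σ_Q (∂_i v)²`.) [folklore] [cite: Giaquinta1984, Ch. III §1 p.65; Balaban1984PropagatorsII, (1.9) p.226] -/
theorem exc_le_gradSq (v : Zd d → ℝ) (z : Zd d) {ρ : ℤ} (hρ : 0 ≤ ρ) :
    exc v z ρ ≤ d * ((2 * ρ + 1 : ℤ) : ℝ) ^ 2 * gradSq v (box z ρ) := by
  classical
  set Q := box z ρ with hQ
  set n : ℝ := ((2 * ρ + 1 : ℤ) : ℝ) with hn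
  have hn0 : 0 < n := by rw [hn]; exact_mod_cast (show (0:ℤ) < 2 * ρ + 1 by linarith)
  have claim : ∀ T : Finset (Fin d), ∃ w : Zd d → ℝ,
      (∀ x ∈ Q, ∀ y ∈ Q, (∀ i, i ∉ T → x i = y i) → w x = w y) ∧
      (∀ j, j ∉ T → ∑ x ∈ Q, (fdiff j w x) ^ 2 ≤ ∑ x ∈ Q, (fdiff j v x) ^ 2) ∧
      (∑ x ∈ Q, (v x - w x) ^ 2 ≤ (T.card : ℝ) * n ^ 2 * ∑ i ∈ T, ∑ x ∈ Q, (fdiff i v x) ^ 2) := by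
    intro T
    induction T using Finset.induction_on with
    | empty =>
      refine ⟨v, fun x _ y _ h => ?_, fun j _ => le_rfl, by simp⟩
      congr 1; funext i; exact h i (by simp)
    | insert j T hj ih =>
      obtain ⟨w, hconst, hgrad, hdev⟩ := ih
      set I := Finset.Icc (z j - ρ) (z j + ρ) with hI
      have hcard : (I.card : ℝ) = n := by rw [hI, hn]; exact card_Icc_line z hρ j
      refine ⟨fun x => (∑ s ∈ I, w (Function.update x j s)) / n, ?_, ?_, ?_⟩
      · intro x hx y hy hxy
        show (∑ s ∈ I, w (Function.update x j s)) / n = (∑ s ∈ I, w (Function.update y j s)) / n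
        congr 1
        refine Finset.sum_congr rfl fun s hs => hconst _ (update_mem_box hx j hs) _ (update_mem_box hy j hs) fun i hi => ?_
        by_cases hij : i = j
        · subst hij; simp
        · rw [Function.update_of_ne hij, Function.update_of_ne hij]
          exact hxy i (by simp [hij, hi])
      · intro j' hj'
        have hj'j : j' ≠ j := fun h => hj' (by simp [h])
        have hj'T : j' ∉ T := fun h => hj' (Finset.mem_insert_of_mem h)
        have hcomm : ∀ x, fdiff j' (fun x => (∑ s ∈ I, w (Function.update x j s)) / n) x =
            (∑ s ∈ I, fdiff j' w (Function.update x j s)) / n := by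
          intro x
          simp only [fdiff]
          rw [← sub_div, ← Finset.sum_sub_distrib]
          congr 1
          refine Finset.sum_congr rfl fun s _ => ?_
          have : Function.update (x + unitVec j') j s = Function.update x j s + unitVec j' := by
            funext i
            by_cases hi : i = j
            · subst hi; simp [unitVec_apply_ne (Ne.symm hj'j)]
            · simp [Function.update_of_ne hi]
          rw [this]
        -- Jensen: `(avg_s g_s)² ≤ avg_s g_s²`
        have hJ : ∀ x, ((∑ s ∈ I, fdiff j' w (Function.update x j s)) / n) ^ 2 ≤ (∑ s ∈ I, (fdiff j' w (Function.update x j s)) ^ 2) / n := by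
          intro x
          have h := sq_sum_le_card_mul_sum_sq (s := I) (f := fun s => fdiff j' w (Function.update x j s))
          rw [hcard] at h
          rw [div_pow, div_le_div_iff₀ (by positivity) hn0]
          calc (∑ s ∈ I, fdiff j' w (Function.update x j s)) ^ 2 * n ≤ (n * ∑ s ∈ I, (fdiff j' w (Function.update x j s)) ^ 2) * n :=
                mul_le_mul_of_nonneg_right h hn0.le
            _ = (∑ s ∈ I, (fdiff j' w (Function.update x j s)) ^ 2) * n ^ 2 := by ring
        calc ∑ x ∈ Q, (fdiff j' (fun x => (∑ s ∈ I, w (Function.update x j s)) / n) x) ^ 2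
            = ∑ x ∈ Q, ((∑ s ∈ I, fdiff j' w (Function.update x j s)) / n) ^ 2 := Finset.sum_congr rfl fun x _ => by rw [hcomm]
          _ ≤ ∑ x ∈ Q, (∑ s ∈ I, (fdiff j' w (Function.update x j s)) ^ 2) / n := Finset.sum_le_sum fun x _ => hJ x
          _ = (∑ x ∈ Q, ∑ s ∈ I, (fdiff j' w (Function.update x j s)) ^ 2) / n := by rw [Finset.sum_div]
          _ = ∑ x ∈ Q, (fdiff j' w x) ^ 2 := by
              rw [hQ, hI, sum_box_lineAvg z hρ j (fun x => (fdiff j' w x) ^ 2), ← hQ, ← hn]; field_simp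
          _ ≤ ∑ x ∈ Q, (fdiff j' v x) ^ 2 := hgrad j' hj'T
      · -- deviation of `w` from its `j`-average, in `ℓ²`
        have hdev' : ∑ x ∈ Q, (w x - (∑ s ∈ I, w (Function.update x j s)) / n) ^ 2 ≤ n ^ 2 * ∑ x ∈ Q, (fdiff j v x) ^ 2 := by
          have h1 : ∀ x ∈ Q, (w x - (∑ s ∈ I, w (Function.update x j s)) / n) ^ 2 ≤ (∑ s ∈ I, (w x - w (Function.update x j s)) ^ 2) / n := by
            intro x _
            have e : w x - (∑ s ∈ I, w (Function.update x j s)) / n = (∑ s ∈ I, (w x - w (Function.update x j s))) / n := by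
              rw [Finset.sum_sub_distrib, Finset.sum_const, nsmul_eq_mul, hcard]; field_simp
            rw [e]
            have h := sq_sum_le_card_mul_sum_sq (s := I) (f := fun s => w x - w (Function.update x j s))
            rw [hcard] at h
            rw [div_pow, div_le_div_iff₀ (by positivity) hn0]
            calc (∑ s ∈ I, (w x - w (Function.update x j s))) ^ 2 * n ≤ (n * ∑ s ∈ I, (w x - w (Function.update x j s)) ^ 2) * n :=
                  mul_le_mul_of_nonneg_right h hn0.le
              _ = (∑ s ∈ I, (w x - w (Function.update x j s)) ^ 2) * n ^ 2 := by ring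
          have h2 : ∀ x ∈ Q, (∑ s ∈ I, (w x - w (Function.update x j s)) ^ 2) / n ≤ n * ∑ t ∈ I, (fdiff j w (Function.update x j t)) ^ 2 := by
            intro x hx
            rw [div_le_iff₀ hn0]
            calc ∑ s ∈ I, (w x - w (Function.update x j s)) ^ 2 ≤ n ^ 2 * ∑ t ∈ I, (fdiff j w (Function.update x j t)) ^ 2 :=
                  sum_sq_sub_update_le z hρ j w hx
              _ = n * (∑ t ∈ I, (fdiff j w (Function.update x j t)) ^ 2) * n := by ring
          calc ∑ x ∈ Q, (w x - (∑ s ∈ I, w (Function.update x j s)) / n) ^ 2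
              ≤ ∑ x ∈ Q, n * ∑ t ∈ I, (fdiff j w (Function.update x j t)) ^ 2 := Finset.sum_le_sum fun x hx => (h1 x hx).trans (h2 x hx)
            _ = n * ∑ x ∈ Q, ∑ t ∈ I, (fdiff j w (Function.update x j t)) ^ 2 := by rw [Finset.mul_sum]
            _ = n * (n * ∑ x ∈ Q, (fdiff j w x) ^ 2) := by rw [hQ, hI, sum_box_lineAvg z hρ j (fun x => (fdiff j w x) ^ 2), ← hQ, ← hn]
            _ = n ^ 2 * ∑ x ∈ Q, (fdiff j w x) ^ 2 := by ring
            _ ≤ n ^ 2 * ∑ x ∈ Q, (fdiff j v x) ^ 2 := mul_le_mul_of_nonneg_left (hgrad j hj) (by positivity)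
        -- combine with the weighted triangle inequality, `t = |T|`
        rw [Finset.card_insert_of_notMem hj, Finset.sum_insert hj]
        rcases Nat.eq_zero_or_pos T.card with hT0 | hTpos
        · -- `T = ∅`: `w = v` on nothing to add — use the deviation bound with `Σ (v − w)² ≤ 0`
          have hT : T = ∅ := Finset.card_eq_zero.mp hT0
          subst hT
          have hvw : ∑ x ∈ Q, (v x - w x) ^ 2 ≤ 0 := by simpa using hdev
          have hvw0 : ∀ x ∈ Q, v x = w x := by
            intro x hx
            have hle : (v x - w x) ^ 2 ≤ 0 := by
              have := Finset.single_le_sum (f := fun x => (v x - w x) ^ 2) (fun _ _ => sq_nonneg _) hx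
              exact this.trans hvw
            have : (v x - w x) ^ 2 = 0 := le_antisymm hle (sq_nonneg _)
            exact sub_eq_zero.mp (pow_eq_zero_iff (two_ne_zero) |>.mp this)
          have e1 : (((∅ : Finset (Fin d)).card + 1 : ℕ) : ℝ) = 1 := by simp
          rw [e1, one_mul, Finset.sum_empty, add_zero]
          calc ∑ x ∈ Q, (v x - (∑ s ∈ I, w (Function.update x j s)) / n) ^ 2
              = ∑ x ∈ Q, (w x - (∑ s ∈ I, w (Function.update x j s)) / n) ^ 2 :=
                Finset.sum_congr rfl fun x hx => by rw [hvw0 x hx]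
            _ ≤ n ^ 2 * ∑ x ∈ Q, (fdiff j v x) ^ 2 := hdev'
        · have htpos : (0 : ℝ) < T.card := by exact_mod_cast hTpos
          set t : ℝ := (T.card : ℝ) with ht
          set S : ℝ := ∑ i ∈ T, ∑ x ∈ Q, (fdiff i v x) ^ 2 with hS
          set sj : ℝ := ∑ x ∈ Q, (fdiff j v x) ^ 2 with hsj
          have hS0 : 0 ≤ S := Finset.sum_nonneg fun _ _ => Finset.sum_nonneg fun _ _ => sq_nonneg _
          have hsj0 : 0 ≤ sj := Finset.sum_nonneg fun _ _ => sq_nonneg _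
          calc ∑ x ∈ Q, (v x - (∑ s ∈ I, w (Function.update x j s)) / n) ^ 2
              = ∑ x ∈ Q, ((v x - w x) + (w x - (∑ s ∈ I, w (Function.update x j s)) / n)) ^ 2 :=
                Finset.sum_congr rfl fun x _ => by ring
            _ ≤ ∑ x ∈ Q, ((1 + 1 / t) * (v x - w x) ^ 2 + (1 + t) * (w x - (∑ s ∈ I, w (Function.update x j s)) / n) ^ 2) :=
                Finset.sum_le_sum fun x _ => add_sq_le_weighted _ _ htpos
            _ = (1 + 1 / t) * ∑ x ∈ Q, (v x - w x) ^ 2 + (1 + t) * ∑ x ∈ Q, (w x - (∑ s ∈ I, w (Function.update x j s)) / n) ^ 2 := by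
                rw [Finset.sum_add_distrib, Finset.mul_sum, Finset.mul_sum]
            _ ≤ (1 + 1 / t) * (t * n ^ 2 * S) + (1 + t) * (n ^ 2 * sj) :=
                add_le_add (mul_le_mul_of_nonneg_left hdev (by positivity)) (mul_le_mul_of_nonneg_left hdev' (by positivity))
            _ = (t + 1) * n ^ 2 * (sj + S) := by field_simp; ring
            _ = ((T.card + 1 : ℕ) : ℝ) * n ^ 2 * (sj + S) := by rw [ht]; push_cast; ring
  obtain ⟨w, hconst, _, hdev⟩ := claim Finset.univ
  have hwc : ∀ x ∈ Q, w x = w z := fun x hx => hconst x hx z (self_mem_box z hρ) fun i hi => absurd (Finset.mem_univ i) hi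
  calc exc v z ρ ≤ ∑ x ∈ Q, (v x - w z) ^ 2 := exc_le_sum_sq_sub v z ρ (w z)
    _ = ∑ x ∈ Q, (v x - w x) ^ 2 := Finset.sum_congr rfl fun x hx => by rw [hwc x hx]
    _ ≤ (Finset.univ : Finset (Fin d)).card * n ^ 2 * ∑ i ∈ (Finset.univ : Finset (Fin d)), ∑ x ∈ Q, (fdiff i v x) ^ 2 := hdev
    _ = d * n ^ 2 * gradSq v Q := by
        rw [Finset.card_univ, Fintype.card_fin, gradSq_def, Finset.sum_comm]


/-! ## §2 Morrey-space telescoping of box averages (d = 3): under `exc v a r ≤ A·(r+1)²` the dyadic averages (`r_k + 1 = 2^k(ρ+1)`) satisfy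
`(avg_{r_k} − avg_{r_{k+1}})² ≤ 4A(ρ+1)⁻¹·2^{−k}`, so `avg_ρ` differs from the top average by `≤ 8√(A∕(ρ+1))` (negative Hölder exponent: the Morrey space `L^{2,2}`). -/

/-- the real cardinality of a box in `d = 3`: `#Q_r(z) = (2r+1)³`, and `(2r+1)³ ≥ (r+1)³`, `(2r+1)³ ≤ 8(r+1)³`. [folklore] -/
theorem card_box_three (hd : d = 3) (z : Zd d) {r : ℤ} (hr : 0 ≤ r) :
    ((box z r).card : ℝ) = (2 * (r : ℝ) + 1) ^ 3 ∧ ((r : ℝ) + 1) ^ 3 ≤ ((box z r).card : ℝ) ∧ ((box z r).card : ℝ) ≤ 8 * ((r : ℝ) + 1) ^ 3 := by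
  subst hd
  have h := card_box z hr
  have e : ((box z r).card : ℝ) = (2 * (r : ℝ) + 1) ^ 3 := by rw [h]; push_cast; ring
  have hr' : (0 : ℝ) ≤ r := by exact_mod_cast hr
  refine ⟨e, ?_, ?_⟩
  · rw [e]; apply pow_le_pow_left₀ (by linarith); linarith
  · rw [e]; nlinarith [pow_le_pow_left₀ (by linarith : (0:ℝ) ≤ 2 * r + 1) (by linarith : 2 * (r : ℝ) + 1 ≤ 2 * (r + 1)) 3]

/-- ONE DYADIC STEP: with `r_k + 1 = 2^k(ρ+1)`, `exc v a r_{k+1} ≤ A(r_{k+1}+1)²` ⟹ `(avg_{r_k} − avg_{r_{k+1}})² ≤ (4A∕(ρ+1))·(1∕2)^k`.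
[folklore] [cite: Giaquinta1984, Ch. III §1 Lemma 1.1 p.70] -/
theorem sq_boxAvg_dyadic_step (hd : d = 3) (v : Zd d → ℝ) (a : Zd d) {ρ : ℤ} (hρ : 0 ≤ ρ) {A : ℝ} (k : ℕ)
    (hexc : exc v a ((2 : ℤ) ^ (k + 1) * (ρ + 1) - 1) ≤ A * ((2 : ℝ) ^ (k + 1) * ((ρ : ℝ) + 1)) ^ 2) :
    (boxAvg v a ((2 : ℤ) ^ k * (ρ + 1) - 1) - boxAvg v a ((2 : ℤ) ^ (k + 1) * (ρ + 1) - 1)) ^ 2 ≤ 4 * A / ((ρ : ℝ) + 1) * (1 / 2) ^ k := by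
  have hρ0 : (0 : ℝ) ≤ (ρ : ℝ) := by exact_mod_cast hρ
  have hρ1 : (0 : ℝ) < (ρ : ℝ) + 1 := by linarith
  have h2k : (1 : ℤ) ≤ (2 : ℤ) ^ k := one_le_pow₀ (by norm_num)
  have hrk0 : (0 : ℤ) ≤ (2 : ℤ) ^ k * (ρ + 1) - 1 := by nlinarith
  have hle : (2 : ℤ) ^ k * (ρ + 1) - 1 ≤ (2 : ℤ) ^ (k + 1) * (ρ + 1) - 1 := by
    rw [pow_succ]; nlinarith
  have hsub : box a ((2 : ℤ) ^ k * (ρ + 1) - 1) ⊆ box a ((2 : ℤ) ^ (k + 1) * (ρ + 1) - 1) := box_mono a hle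
  have hnest := card_mul_sq_sub_le_exc v hsub
  obtain ⟨_, hcardlo, _⟩ := card_box_three hd a hrk0
  -- `#Q_{r_k} ≥ (r_k+1)³ = 8^k (ρ+1)³`
  have hcard : ((2 : ℝ) ^ k * ((ρ : ℝ) + 1)) ^ 3 ≤ ((box a ((2 : ℤ) ^ k * (ρ + 1) - 1)).card : ℝ) := by
    have e : ((((2 : ℤ) ^ k * (ρ + 1) - 1 : ℤ) : ℝ) + 1) = (2 : ℝ) ^ k * ((ρ : ℝ) + 1) := by push_cast; ring
    rw [← e]; exact hcardlo
  have hpos : (0 : ℝ) < ((2 : ℝ) ^ k * ((ρ : ℝ) + 1)) ^ 3 := by positivity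
  set D := (boxAvg v a ((2 : ℤ) ^ k * (ρ + 1) - 1) - boxAvg v a ((2 : ℤ) ^ (k + 1) * (ρ + 1) - 1)) ^ 2 with hD
  have hD0 : 0 ≤ D := sq_nonneg _
  have h1 : ((2 : ℝ) ^ k * ((ρ : ℝ) + 1)) ^ 3 * D ≤ A * ((2 : ℝ) ^ (k + 1) * ((ρ : ℝ) + 1)) ^ 2 :=
    (mul_le_mul_of_nonneg_right hcard hD0).trans (hnest.trans hexc)
  have h1' : D ≤ A * ((2 : ℝ) ^ (k + 1) * ((ρ : ℝ) + 1)) ^ 2 / ((2 : ℝ) ^ k * ((ρ : ℝ) + 1)) ^ 3 := by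
    rw [le_div_iff₀ hpos]; linarith [h1]
  refine h1'.trans (le_of_eq ?_)
  have h2 : (2 : ℝ) ^ k ≠ 0 := pow_ne_zero _ two_ne_zero
  rw [one_div_pow, pow_succ]
  field_simp
  ring

/-- geometric majorant: `(1∕2)^k ≤ ((3∕4)^k)²`. [folklore] -/
theorem half_pow_le_sq (k : ℕ) : (1 / 2 : ℝ) ^ k ≤ ((3 / 4 : ℝ) ^ k) ^ 2 := by
  rw [← pow_mul, mul_comm, pow_mul]
  exact pow_le_pow_left₀ (by norm_num) (by norm_num) k

/-- `Σ_{k<K} (3∕4)^k ≤ 4`. [folklore] -/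
theorem sum_geom_three_quarters_le (K : ℕ) : ∑ k ∈ Finset.range K, (3 / 4 : ℝ) ^ k ≤ 4 := by
  have h := geom_sum_eq (x := (3 / 4 : ℝ)) (by norm_num) K
  rw [h]
  have hK : (0 : ℝ) ≤ (3 / 4 : ℝ) ^ K := by positivity
  have : ((3 / 4 : ℝ) ^ K - 1) / (3 / 4 - 1) = 4 * (1 - (3 / 4 : ℝ) ^ K) := by field_simp; ring
  rw [this]; nlinarith

/-- ★ **DYADIC TELESCOPING**: if `exc v a r_k ≤ A(r_k+1)²` for the dyadic radii `r_k + 1 = 2^k(ρ+1)`, `k ≤ K`, then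
`(avg_{Q_ρ(a)} v − avg_{Q_{r_K}(a)} v)² ≤ 64·A∕(ρ+1)`. [folklore] [cite: Giaquinta1984, Ch. III §1 Thm 1.2 p.70] -/
theorem sq_boxAvg_sub_dyadic_le (hd : d = 3) (v : Zd d → ℝ) (a : Zd d) {ρ : ℤ} (hρ : 0 ≤ ρ) {A : ℝ} (hA : 0 ≤ A) (K : ℕ)
    (hexc : ∀ k, k ≤ K → exc v a ((2 : ℤ) ^ k * (ρ + 1) - 1) ≤ A * ((2 : ℝ) ^ k * ((ρ : ℝ) + 1)) ^ 2) :
    (boxAvg v a ρ - boxAvg v a ((2 : ℤ) ^ K * (ρ + 1) - 1)) ^ 2 ≤ 64 * A / ((ρ : ℝ) + 1) := by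
  have hρ0 : (0 : ℝ) ≤ (ρ : ℝ) := by exact_mod_cast hρ
  have hρ1 : (0 : ℝ) < (ρ : ℝ) + 1 := by linarith
  set c : ℝ := 4 * A / ((ρ : ℝ) + 1) with hc
  have hc0 : 0 ≤ c := by positivity
  set g : ℕ → ℝ := fun k => boxAvg v a ((2 : ℤ) ^ k * (ρ + 1) - 1) with hg
  -- each step is at most `√c · (3/4)^k`
  have hstep : ∀ k, k < K → |g k - g (k + 1)| ≤ Real.sqrt c * (3 / 4 : ℝ) ^ k := by
    intro k hk
    have h1 : (g k - g (k + 1)) ^ 2 ≤ c * (1 / 2 : ℝ) ^ k := sq_boxAvg_dyadic_step hd v a hρ k (hexc (k + 1) hk)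
    have h2 : (g k - g (k + 1)) ^ 2 ≤ (Real.sqrt c * (3 / 4 : ℝ) ^ k) ^ 2 := by
      rw [mul_pow, Real.sq_sqrt hc0]
      exact h1.trans (mul_le_mul_of_nonneg_left (half_pow_le_sq k) hc0)
    exact abs_le_of_sq_le_sq' h2 (by positivity) |>.2 |> fun h => abs_le.mpr ⟨by
      have := abs_le_of_sq_le_sq' h2 (by positivity); linarith [this.1], h⟩
  -- telescoping
  have htel : g 0 - g K = ∑ k ∈ Finset.range K, (g k - g (k + 1)) := by
    rw [← neg_sub, ← Finset.sum_range_sub g K, ← Finset.sum_neg_distrib]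
    exact Finset.sum_congr rfl fun k _ => by ring
  have h0 : g 0 = boxAvg v a ρ := by rw [hg]; simp
  have habs : |boxAvg v a ρ - g K| ≤ Real.sqrt c * 4 := by
    rw [← h0, htel]
    calc |∑ k ∈ Finset.range K, (g k - g (k + 1))| ≤ ∑ k ∈ Finset.range K, |g k - g (k + 1)| := Finset.abs_sum_le_sum_abs _ _
      _ ≤ ∑ k ∈ Finset.range K, Real.sqrt c * (3 / 4 : ℝ) ^ k := Finset.sum_le_sum fun k hk => hstep k (Finset.mem_range.mp hk)
      _ = Real.sqrt c * ∑ k ∈ Finset.range K, (3 / 4 : ℝ) ^ k := by rw [Finset.mul_sum]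
      _ ≤ Real.sqrt c * 4 := mul_le_mul_of_nonneg_left (sum_geom_three_quarters_le K) (Real.sqrt_nonneg _)
  calc (boxAvg v a ρ - g K) ^ 2 = |boxAvg v a ρ - g K| ^ 2 := (sq_abs _).symm
    _ ≤ (Real.sqrt c * 4) ^ 2 := pow_le_pow_left₀ (abs_nonneg _) habs 2
    _ = 16 * c := by rw [mul_pow, Real.sq_sqrt hc0]; ring
    _ = 64 * A / ((ρ : ℝ) + 1) := by rw [hc]; ring

/-- ★ **COMPARISON WITH A MASTER BOX**: `Q_{r}(a) ⊆ Q_{R}(z₀)`, `ρ ≤ r`, `(R+1)² ≤ 16(r+1)²`, `exc v z₀ R ≤ A(R+1)²` ⟹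
`#Q_ρ(a)·(avg_{Q_r(a)} v − avg_{Q_R(z₀)} v)² ≤ 128·A·(ρ+1)²`. [folklore] [cite: Giaquinta1984, Ch. III §1 Lemma 1.1 p.70] -/
theorem card_mul_sq_boxAvg_sub_master_le (hd : d = 3) (v : Zd d → ℝ) (a z₀ : Zd d) {ρ r R : ℤ} (hρ : 0 ≤ ρ) (hρr : ρ ≤ r) {A : ℝ} (hA : 0 ≤ A)
    (hsub : box a r ⊆ box z₀ R) (hRr : ((R : ℝ) + 1) ^ 2 ≤ 16 * ((r : ℝ) + 1) ^ 2) (hexc : exc v z₀ R ≤ A * ((R : ℝ) + 1) ^ 2) :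
    ((box a ρ).card : ℝ) * (boxAvg v a r - boxAvg v z₀ R) ^ 2 ≤ 128 * A * ((ρ : ℝ) + 1) ^ 2 := by
  have hr : 0 ≤ r := hρ.trans hρr
  have hρR : (0 : ℝ) ≤ ρ := by exact_mod_cast hρ
  have hρrR : (ρ : ℝ) ≤ r := by exact_mod_cast hρr
  obtain ⟨_, hrlo, _⟩ := card_box_three hd a hr
  obtain ⟨_, _, hρhi⟩ := card_box_three hd a hρ
  set D := (boxAvg v a r - boxAvg v z₀ R) ^ 2 with hD
  have hD0 : 0 ≤ D := sq_nonneg _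
  have hnest : ((box a r).card : ℝ) * D ≤ A * ((R : ℝ) + 1) ^ 2 := (card_mul_sq_sub_le_exc v hsub).trans hexc
  have hr1 : (0 : ℝ) < ((r : ℝ) + 1) ^ 3 := by positivity
  -- `(r+1)³·D ≤ 16A(r+1)²` ⟹ `(r+1)·D ≤ 16A`
  have h1 : ((r : ℝ) + 1) ^ 3 * D ≤ 16 * A * ((r : ℝ) + 1) ^ 2 :=
    (mul_le_mul_of_nonneg_right hrlo hD0).trans (hnest.trans (by nlinarith))
  have h2 : ((r : ℝ) + 1) * D ≤ 16 * A := by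
    have hr1' : (0 : ℝ) < ((r : ℝ) + 1) ^ 2 := by positivity
    nlinarith
  calc ((box a ρ).card : ℝ) * D ≤ 8 * ((ρ : ℝ) + 1) ^ 3 * D := mul_le_mul_of_nonneg_right hρhi hD0
    _ = 8 * ((ρ : ℝ) + 1) ^ 2 * (((ρ : ℝ) + 1) * D) := by ring
    _ ≤ 8 * ((ρ : ℝ) + 1) ^ 2 * (((r : ℝ) + 1) * D) := by
        apply mul_le_mul_of_nonneg_left _ (by positivity)
        exact mul_le_mul_of_nonneg_right (by linarith) hD0
    _ ≤ 8 * ((ρ : ℝ) + 1) ^ 2 * (16 * A) := mul_le_mul_of_nonneg_left h2 (by positivity)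
    _ = 128 * A * ((ρ : ℝ) + 1) ^ 2 := by ring


end Summit.QuantumFields.YangMills.Theorems.Prop7LatticeBoxPoincareL2

end
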